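import Mathlib.ModelTheory.Algebra.Ring.FreeCommRing
import Mathlib.ModelTheory.Algebra.Field.Basic
import Mathlib.Algebra.MvPolynomial.PDeriv
import HarnessLib

/-!
# Ring terms for generic polynomials and their partial derivatives

Topic `Literature/ModelTheory/PseudofiniteFields`.  A complement to the `Terms` section of
`DefinablePredicates.lean` (`exists_term_realize_pow / _sum / _prod / _boxSum`): the routine step
"this polynomial expression in the parameters `v : α → K` is the value of ONE term of the language
of rings, uniformly in the field `K` and in `v`", in the shape
`∃ s : Language.ring.Term α, ∀ K v, s.realize v = ⋯` that feeds `definable_termEq` /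
`definable_termNe` there (Chatzidakis–van den Dries–Macintyre 1992, §2, "by pure logic": to say
"there is a polynomial of degree `≤ N` such that …" in first-order terms one quantifies over the
coefficients of the GENERIC polynomial of multi-degree `≤ N`; the same device is Mathlib's
`FirstOrder.Ring.genericPolyMap` in the proof of Ax–Grothendieck).

* `exists_term_realize_eval_map` — the master statement.  For a polynomial
  `P ∈ (FreeCommRing α)[X_σ]` whose coefficients are integer polynomials in the variables `α`
  and a point `x : σ → FreeCommRing α` with such coordinates, some ring term realises, at every
  valuation `v : α → K`, the value `(map (lift v) P)(lift v ∘ x)` of the specialised polynomial at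
  the specialised point: the term of `eval x P ∈ FreeCommRing α` given by Mathlib's
  `FirstOrder.Ring.termOfFreeCommRing`, specialisation being a ring homomorphism
  (`MvPolynomial.eval₂_comp`).
* `exists_term_realize_eval_pderiv_map` — the same with a partial derivative `∂/∂x_j` inserted,
  as specialisation commutes with `MvPolynomial.pderiv` (`MvPolynomial.pderiv_map`).
* `exists_term_realize_boxEval`, `exists_term_realize_boxPDerivEval` — the case everybody uses:
  the generic polynomial `P = Σ_i d_i X^{e i}` with COEFFICIENT VARIABLES `d_i := fd i` (`i` in a
  finite index type, arbitrary exponent vectors `e i : σ →₀ ℕ`) evaluated at the POINT VARIABLES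
  `x_l := fx l`, i.e. `MvPolynomial.eval x (Σ_i monomial (e i) d_i)`, and its partial derivatives
  `MvPolynomial.eval x (∂_j Σ_i monomial (e i) d_i)`, are ring terms.  With `σ = Fin m`,
  `i = β : Fin m → Fin (N + 1)` and `e β = β` the first is the box sum of
  `DefinablePredicates.exists_term_realize_boxSum` (there written out as `Σ_β d_β ∏_l x_l^{β_l}`).

Nothing about fields is used (any commutative compatible ring would do); the statements quantify
over fields `K : Type` with `[CompatibleRing K]` only to match the toolkit's shape.  The plane-curve
special case (one polynomial in two variables and its `Y`-derivative, `genPolyFR`,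
`genPolyDerivFR`) is in `PlaneCurvesPseudofinite.lean`.

## References

* [ChatzidakisVanDenDriesMacintyre1992] Z. Chatzidakis, L. van den Dries, A. Macintyre, Definable
  sets over finite fields, J. reine angew. Math. 427 (1992) 107–135, §2.
* Mathlib, `Mathlib/ModelTheory/Algebra/Ring/FreeCommRing.lean` (`termOfFreeCommRing`) and
  `Mathlib/FieldTheory/AxGrothendieck.lean` (generic polynomial maps as ring terms).

## Not here

Definability corollaries (`= 0`, `≠ 0`: one line from `DefinablePredicates.definable_termEq`),
determinants of matrices of terms (Jacobians), higher derivatives.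
-/

namespace Literature.ModelTheory.PseudofiniteFields

open FirstOrder FirstOrder.Language FirstOrder.Ring

section TermBoxPolynomial

variable {α σ : Type}

/-- **Polynomial expressions in the variables are ring terms, uniformly.**  For a polynomial `P`
in indeterminates `σ` with coefficients in the free commutative ring on `α` and a point
`x : σ → FreeCommRing α`, some ring term realises, in every field `K` at every valuation
`v : α → K`, the value at the specialised point `lift v ∘ x` of the specialised polynomial
`map (lift v) P`; the term is that of `eval x P ∈ FreeCommRing α`
(`FirstOrder.Ring.termOfFreeCommRing`). [folklore] -/
theorem exists_term_realize_eval_map (x : σ → FreeCommRing α)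
    (P : MvPolynomial σ (FreeCommRing α)) :
    ∃ s : Language.ring.Term α, ∀ (K : Type) [Field K] [CompatibleRing K] (v : α → K),
      s.realize v = MvPolynomial.eval (fun l => FreeCommRing.lift v (x l))
        (MvPolynomial.map (FreeCommRing.lift v) P) := by
  refine ⟨termOfFreeCommRing (MvPolynomial.eval x P), fun K _ _ v => ?_⟩
  rw [realize_termOfFreeCommRing]
  exact (MvPolynomial.eval₂_comp _ _ _).trans (MvPolynomial.eval₂_eq_eval_map _ _ _)

/-- **Partial derivatives of polynomial expressions in the variables are ring terms, uniformly.**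
For `P ∈ (FreeCommRing α)[X_σ]`, a point `x : σ → FreeCommRing α` and `j : σ`, some ring term
realises, at every valuation `v : α → K`, the value at `lift v ∘ x` of `∂/∂x_j` of the
specialised polynomial `map (lift v) P` (specialisation commutes with partial derivatives,
`MvPolynomial.pderiv_map`). [folklore] -/
theorem exists_term_realize_eval_pderiv_map (x : σ → FreeCommRing α)
    (P : MvPolynomial σ (FreeCommRing α)) (j : σ) :
    ∃ s : Language.ring.Term α, ∀ (K : Type) [Field K] [CompatibleRing K] (v : α → K),
      s.realize v = MvPolynomial.eval (fun l => FreeCommRing.lift v (x l))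
        (MvPolynomial.pderiv j (MvPolynomial.map (FreeCommRing.lift v) P)) := by
  obtain ⟨s, hs⟩ := exists_term_realize_eval_map x (MvPolynomial.pderiv j P)
  exact ⟨s, fun K _ _ v => by rw [hs, MvPolynomial.pderiv_map]⟩

/-- **The generic polynomial at the generic point is a ring term.**  For coefficient variables
`d_i := fd i` (`i` in a finite index type `ι`), exponent vectors `e i : σ →₀ ℕ` and point
variables `x_l := fx l`, some ring term realises `P(x) = MvPolynomial.eval x (Σ_i monomial (e i) d_i)`
for the generic polynomial `P := Σ_i d_i X^{e i}`, uniformly in the field `K` and the valuation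
`v : α → K`. [folklore] -/
theorem exists_term_realize_boxEval {ι : Type} [Fintype ι] (e : ι → σ →₀ ℕ) (fd : ι → α)
    (fx : σ → α) :
    ∃ s : Language.ring.Term α, ∀ (K : Type) [Field K] [CompatibleRing K] (v : α → K),
      s.realize v = MvPolynomial.eval (fun l => v (fx l))
        (∑ i, MvPolynomial.monomial (e i) (v (fd i))) := by
  obtain ⟨s, hs⟩ := exists_term_realize_eval_map (fun l => FreeCommRing.of (fx l))
    (∑ i, MvPolynomial.monomial (e i) (FreeCommRing.of (fd i)))
  refine ⟨s, fun K _ _ v => ?_⟩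
  rw [hs, map_sum]
  simp only [FreeCommRing.lift_of, MvPolynomial.map_monomial]

/-- **Partial derivatives of the generic polynomial at the generic point are ring terms.**  For
coefficient variables `d_i := fd i` (`i` in a finite index type `ι`), exponent vectors
`e i : σ →₀ ℕ`, point variables `x_l := fx l` and `j : σ`, some ring term realises
`(∂P/∂x_j)(x) = MvPolynomial.eval x (pderiv j (Σ_i monomial (e i) d_i))` for the generic
polynomial `P := Σ_i d_i X^{e i}`, uniformly in the field `K` and the valuation `v : α → K`.
[folklore] -/
theorem exists_term_realize_boxPDerivEval {ι : Type} [Fintype ι] (e : ι → σ →₀ ℕ) (fd : ι → α)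
    (fx : σ → α) (j : σ) :
    ∃ s : Language.ring.Term α, ∀ (K : Type) [Field K] [CompatibleRing K] (v : α → K),
      s.realize v = MvPolynomial.eval (fun l => v (fx l))
        (MvPolynomial.pderiv j (∑ i, MvPolynomial.monomial (e i) (v (fd i)))) := by
  obtain ⟨s, hs⟩ := exists_term_realize_eval_pderiv_map (fun l => FreeCommRing.of (fx l))
    (∑ i, MvPolynomial.monomial (e i) (FreeCommRing.of (fd i))) j
  refine ⟨s, fun K _ _ v => ?_⟩
  rw [hs, map_sum]
  simp only [FreeCommRing.lift_of, MvPolynomial.map_monomial]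

end TermBoxPolynomial

end Literature.ModelTheory.PseudofiniteFields
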